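import Literature.Analysis.Complex.FlatTubeFourierSynthesis
import Literature.Analysis.Complex.HolomorphicParametricIntegral
import Mathlib.Analysis.SpecialFunctions.JapaneseBracket
import HarnessLib

/-!
# The flat tube theorem by Fourier transform, III: the holomorphic extension to the `ℓ¹`-tube

Analysis/Complex support file (everything proved; no definitions, no named facts), concluding
`FlatTubeFourierDecay` and `FlatTubeFourierSynthesis`: the **Malgrange–Zerner "flat tube"
theorem in tempered form** (`exists_holomorphic_extension_l1Tube`). Let `T` be a functional on
`k`-tuples of functions `ℝ → ℂ` (a distribution in `k` real variables with the Gaussian window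
`e^{-bs²}` built into each slot) such that every slot `i`, at every tuple `θ` of Schwartz
functions, is represented by a function holomorphic in the strip `{|Im z| < a}`,

  `T(θ[i ↦ ϑ]) = ∫ gᵢ(s) e^{-bs²} ϑ(s) ds`  (all Schwartz `ϑ`),  `‖gᵢ(x+iy)‖ ≤ Bᵢ(θ, c) e^{κ|x|}` (`|y| ≤ c < a`),

with bounds `Bᵢ` growing at most polynomially in the frequencies at tuples of modulated Gaussians
`ψ_{p_j}(s) = e^{-bs²} e^{-2πip_js}`. Then there is a function `F` **holomorphic on the tube over the
`ℓ¹`-ball** `{z ∈ ℂᵏ | ∑ⱼ |Im zⱼ| < a}` — the convex hull of the `k` flat tubes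
`{Im z_j ∈ (-a, a), Im z_l = 0 (l ≠ j)}` — bounded on every closed sub-tube, which represents `T`:

  `T(e^{-b·²}ϑ₁, …, e^{-b·²}ϑ_k) = ∫_{ℝᵏ} F(x) ∏ⱼ ϑⱼ(xⱼ) dx`  for all Schwartz `ϑⱼ`

(so that `F(x) e^{2b∑xⱼ²}` is the density of `T` on products `∏ χⱼ(xⱼ)` of test functions of the
form `χ = e^{-2b·²}ϑ`, e.g. all compactly supported ones, and `F(z) e^{2b∑zⱼ²}` is its holomorphic
extension). The function is the Fourier–Laplace integral `F(z) = ∫ Φ(p) e^{2πi p·z} dp` of the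
Gaussian-windowed Fourier data `Φ(p) = T(ψ_{p_1}, …, ψ_{p_k})`, which converges and is holomorphic on
the `ℓ¹`-tube because `‖Φ(p)‖ ≲ (1 + ‖p‖)ᴺ e^{-2πc‖p‖_∞}` for every `c < a`
(`FlatTubeFourierDecay`: each slot gives `e^{-2πc|pᵢ|}`, the best slot gives the sup norm, and
`|e^{2πip·z}| ≤ e^{2π‖p‖_∞ ‖Im z‖₁}`); the representation is `FlatTubeFourierSynthesis` plus
Fubini. This is the theorem Osterwalder–Schrader invoke (Comm. Math. Phys. 42 (1975), p. 292:
"It follows now from the Malgrange-Zerner theorem … that there is an analytic function … analytic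
in the convex envelope of the union of all the flat tubes") to continue the Schwinger functions
jointly in all (logarithmic) time variables; classical statement and proof (without growth
hypotheses, by envelopes of holomorphy): H. Epstein, Brandeis lectures 1965.

* `integrable_one_add_norm_pow_mul_exp_neg` — `(1 + ‖p‖)ᴺ e^{-δ‖p‖}` is integrable on `ℝᵏ`;
* `differentiableOn_fourierLaplace_l1Tube`, `norm_fourierLaplace_le` — holomorphy and bounds of
  `z ↦ ∫ Φ(p) e^{2πi p·z} dp` on the `ℓ¹`-tube for continuous `Φ` with the above decay;
* `integral_fourierLaplace_mul_prod_eq` — `∫ F(x) ∏ ϑⱼ(xⱼ) dx = ∫ Φ(p) ∏ (𝓕⁻ϑⱼ)(pⱼ) dp`;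
* `exists_holomorphic_extension_l1Tube` — **the flat tube theorem**.

## References

* H. Epstein, *Some analytic properties of scattering amplitudes in quantum field theory*, in:
  *Axiomatic Field Theory* (Brandeis Summer Institute 1965), Gordon and Breach 1966.
* K. Osterwalder, R. Schrader, *Axioms for Euclidean Green's functions II*, Comm. Math. Phys. 42
  (1975) 281–305, §V.1 p. 292. [OsterwalderSchraderCMP1975]

Everything here is elementary and tagged folklore.
-/

noncomputable section

open _root_.Complex Set MeasureTheory Filter Real SchwartzMap Module
open scoped _root_.Topology FourierTransform

namespace Literature.Analysis.Complex

variable {k : ℕ} {a b κ : ℝ}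

/-! ### Integrability of `(1 + ‖p‖)ᴺ e^{-δ‖p‖}` on `ℝᵏ` -/

/-- `(1 + t)ᴹ e^{-δ t} ≤ M! δ^{-M} e^{δ}` for `t ≥ 0`, `δ > 0` (from `yᴹ/M! ≤ eʸ`). [folklore] -/
theorem one_add_pow_mul_exp_neg_le {δ : ℝ} (hδ : 0 < δ) (M : ℕ) {t : ℝ} (ht : 0 ≤ t) :
    (1 + t) ^ M * Real.exp (-δ * t) ≤ M.factorial * δ⁻¹ ^ M * Real.exp δ := by
  have h := Real.pow_div_factorial_le_exp (δ * (1 + t)) (by positivity) M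
  rw [div_le_iff₀ (by positivity), mul_pow] at h
  have hδM : 0 < δ ^ M := pow_pos hδ M
  calc (1 + t) ^ M * Real.exp (-δ * t)
      = (δ ^ M * (1 + t) ^ M) * (δ⁻¹ ^ M * Real.exp (-δ * t)) := by
        rw [inv_pow]; field_simp
    _ ≤ (Real.exp (δ * (1 + t)) * M.factorial) * (δ⁻¹ ^ M * Real.exp (-δ * t)) := by
        gcongr
    _ = M.factorial * δ⁻¹ ^ M * Real.exp δ := by
        rw [show δ * (1 + t) = δ + -(-δ * t) by ring, Real.exp_add, Real.exp_neg]
        field_simp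

/-- **`(1 + ‖p‖)ᴺ e^{-δ‖p‖}` is integrable on `ℝᵏ`** (`δ > 0`): it is dominated by a multiple of
`(1 + ‖p‖)^{-(k+1)}`, integrable by `integrable_one_add_norm`. [folklore] -/
theorem integrable_one_add_norm_pow_mul_exp_neg {δ : ℝ} (hδ : 0 < δ) (N : ℕ) :
    Integrable fun p : Fin k → ℝ => (1 + ‖p‖) ^ N * Real.exp (-δ * ‖p‖) := by
  have hdim : (finrank ℝ (Fin k → ℝ) : ℝ) < (k + 1 : ℕ) := by simp
  have hint : Integrable (fun p : Fin k → ℝ => (1 + ‖p‖) ^ (-((k + 1 : ℕ) : ℝ))) :=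
    integrable_one_add_norm hdim
  set K : ℝ := (N + (k + 1)).factorial * δ⁻¹ ^ (N + (k + 1)) * Real.exp δ with hK
  refine (hint.const_mul K).mono' (by fun_prop) (Eventually.of_forall fun p => ?_)
  rw [Real.norm_eq_abs, abs_of_nonneg (by positivity)]
  have h := one_add_pow_mul_exp_neg_le hδ (N + (k + 1)) (norm_nonneg p)
  have hpos : 0 < (1 + ‖p‖) ^ (k + 1) := by positivity
  rw [Real.rpow_neg (by positivity), Real.rpow_natCast, le_mul_inv_iff₀ hpos]
  calc (1 + ‖p‖) ^ N * Real.exp (-δ * ‖p‖) * (1 + ‖p‖) ^ (k + 1)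
      = (1 + ‖p‖) ^ (N + (k + 1)) * Real.exp (-δ * ‖p‖) := by rw [pow_add]; ring
    _ ≤ K := h

/-! ### The Fourier–Laplace integral on the `ℓ¹`-tube -/

/-- Modulus of the Fourier–Laplace kernel: `|e^{2πi ∑ pⱼ zⱼ}| ≤ e^{2π ‖p‖ ∑ |Im zⱼ|}`. [folklore] -/
theorem norm_cexp_two_pi_I_sum_le (p : Fin k → ℝ) (z : Fin k → ℂ) :
    ‖Complex.exp (2 * π * I * ∑ j, (p j : ℂ) * z j)‖ ≤ Real.exp (2 * π * ‖p‖ * ∑ j, |(z j).im|) := by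
  rw [Complex.norm_exp]
  refine Real.exp_le_exp.2 ?_
  have hre : (2 * π * I * ∑ j, (p j : ℂ) * z j).re = -(2 * π * ∑ j, p j * (z j).im) := by
    simp [mul_re, mul_im, re_sum, Finset.mul_sum]
  rw [hre, Finset.mul_sum, Finset.mul_sum, ← Finset.sum_neg_distrib]
  refine Finset.sum_le_sum fun j _ => ?_
  have h1 : -(2 * π * (p j * (z j).im)) ≤ 2 * π * (|p j| * |(z j).im|) := by
    have : -(p j * (z j).im) ≤ |p j| * |(z j).im| := by
      rw [← abs_mul]; exact neg_le_abs _
    nlinarith [Real.pi_pos]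
  refine h1.trans ?_
  have hpj : |p j| ≤ ‖p‖ := by simpa [Real.norm_eq_abs] using norm_le_pi_norm p j
  have := mul_le_mul_of_nonneg_right hpj (abs_nonneg ((z j).im))
  nlinarith [Real.pi_pos, abs_nonneg ((z j).im)]

/-- **Holomorphy of the Fourier–Laplace integral on the `ℓ¹`-tube.** If `Φ : ℝᵏ → ℂ` is continuous
and for every `c < a` satisfies `‖Φ(p)‖ ≤ C (1 + ‖p‖)ᴺ e^{-2πc‖p‖}` (sup norm), then
`F(z) = ∫ Φ(p) e^{2πi ∑ pⱼ zⱼ} dp` is complex differentiable on `{∑ⱼ |Im zⱼ| < a}` (dominated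
parameter integral of a holomorphic family,
`Literature.Analysis.Complex.differentiableOn_integral_of_dominated`). [folklore] -/
theorem differentiableOn_fourierLaplace_l1Tube {Φ : (Fin k → ℝ) → ℂ} (hΦ : Continuous Φ)
    (hdecay : ∀ c : ℝ, c < a → ∃ (C : ℝ) (N : ℕ), ∀ p, ‖Φ p‖ ≤ C * (1 + ‖p‖) ^ N * Real.exp (-(2 * π * c * ‖p‖))) :
    DifferentiableOn ℂ (fun z : Fin k → ℂ => ∫ p : Fin k → ℝ, Φ p * Complex.exp (2 * π * I * ∑ j, (p j : ℂ) * z j))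
      {z : Fin k → ℂ | ∑ j, |(z j).im| < a} := by
  refine differentiableOn_integral_of_dominated (fun z _ => ?_) (Eventually.of_forall fun p => ?_)
    fun z₀ hz₀ => ?_
  · exact (hΦ.mul (Complex.continuous_exp.comp (continuous_const.mul
      (continuous_finsetSum _ fun j _ => (Complex.continuous_ofReal.comp (continuous_apply j)).mul
        continuous_const)))).aestronglyMeasurable
  · exact ((differentiable_const _).mul (Complex.differentiable_exp.comp ((differentiable_const _).mul
      (Differentiable.fun_sum fun j _ => (differentiable_const _).mul (differentiable_apply j))))).differentiableOn
  · -- local domination around `z₀`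
    set s₀ : ℝ := ∑ j, |(z₀ j).im| with hs₀
    have hs₀a : s₀ < a := hz₀
    set R : ℝ := (a - s₀) / 2 / (k + 1) with hR
    have hR0 : 0 < R := div_pos (by linarith) (by positivity)
    have hkR : (k + 1 : ℝ) * R = (a - s₀) / 2 := by
      rw [hR]; exact mul_div_cancel₀ _ (ne_of_gt (by positivity))
    obtain ⟨C, N, hC⟩ := hdecay (s₀ + (k + 1) * R) (by nlinarith)
    refine ⟨R, hR0, fun z hz => ?_, fun p => C * ((1 + ‖p‖) ^ N * Real.exp (-(2 * π * R) * ‖p‖)),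
      (integrable_one_add_norm_pow_mul_exp_neg (by positivity) N).const_mul C,
      Eventually.of_forall fun p z hz => ?_⟩
    · -- the ball stays in the tube
      show ∑ j, |(z j).im| < a
      have hj : ∀ j, |(z j).im| ≤ |(z₀ j).im| + R := fun j => by
        have h1 : ‖z j - z₀ j‖ < R := by
          have := norm_le_pi_norm (z - z₀) j
          rw [Pi.sub_apply] at this
          exact this.trans_lt (mem_ball_iff_norm.1 hz)
        have h2 : |(z j).im - (z₀ j).im| < R := by
          rw [← Complex.sub_im]; exact (abs_im_le_norm _).trans_lt h1
        linarith [abs_sub_abs_le_abs_sub (z j).im (z₀ j).im]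
      calc ∑ j, |(z j).im| ≤ ∑ j, (|(z₀ j).im| + R) := Finset.sum_le_sum fun j _ => hj j
        _ = s₀ + k * R := by rw [Finset.sum_add_distrib, Finset.sum_const, Finset.card_fin]; simp [hs₀]
        _ < a := by nlinarith
    · -- the bound
      have hj : ∀ j, |(z j).im| ≤ |(z₀ j).im| + R := fun j => by
        have h1 : ‖z j - z₀ j‖ < R := by
          have := norm_le_pi_norm (z - z₀) j
          rw [Pi.sub_apply] at this
          exact this.trans_lt (mem_ball_iff_norm.1 hz)
        have h2 : |(z j).im - (z₀ j).im| < R := by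
          rw [← Complex.sub_im]; exact (abs_im_le_norm _).trans_lt h1
        linarith [abs_sub_abs_le_abs_sub (z j).im (z₀ j).im]
      have hsum : ∑ j, |(z j).im| ≤ s₀ + k * R := by
        calc ∑ j, |(z j).im| ≤ ∑ j, (|(z₀ j).im| + R) := Finset.sum_le_sum fun j _ => hj j
          _ = s₀ + k * R := by rw [Finset.sum_add_distrib, Finset.sum_const, Finset.card_fin]; simp [hs₀]
      rw [norm_mul]
      have hC0 : 0 ≤ C := by
        have h := hC 0
        simp only [norm_zero, add_zero, one_pow, mul_one, mul_zero, neg_zero, Real.exp_zero] at h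
        exact (norm_nonneg _).trans h
      calc ‖Φ p‖ * ‖Complex.exp (2 * π * I * ∑ j, (p j : ℂ) * z j)‖
          ≤ (C * (1 + ‖p‖) ^ N * Real.exp (-(2 * π * (s₀ + (k + 1) * R) * ‖p‖))) *
              Real.exp (2 * π * ‖p‖ * (s₀ + k * R)) := by
            refine mul_le_mul (hC p) ((norm_cexp_two_pi_I_sum_le p z).trans
              (Real.exp_le_exp.2 ?_)) (norm_nonneg _) ?_
            · exact mul_le_mul_of_nonneg_left hsum (by positivity)
            · exact le_trans (norm_nonneg _) (hC p)
        _ = C * ((1 + ‖p‖) ^ N * Real.exp (-(2 * π * R) * ‖p‖)) := by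
            rw [mul_assoc, mul_assoc, mul_assoc, ← Real.exp_add]
            congr 3
            ring

/-- **Bounds for the Fourier–Laplace integral on closed sub-tubes**: under the same decay, for every
`c < a` there is `K` with `‖∫ Φ(p) e^{2πi p·z} dp‖ ≤ K` whenever `∑|Im zⱼ| ≤ c` (uniformly in
`Re z`). [folklore] -/
theorem norm_fourierLaplace_le {Φ : (Fin k → ℝ) → ℂ}
    (hdecay : ∀ c : ℝ, c < a → ∃ (C : ℝ) (N : ℕ), ∀ p, ‖Φ p‖ ≤ C * (1 + ‖p‖) ^ N * Real.exp (-(2 * π * c * ‖p‖)))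
    {c : ℝ} (hca : c < a) :
    ∃ K : ℝ, ∀ z : Fin k → ℂ, ∑ j, |(z j).im| ≤ c →
      ‖∫ p : Fin k → ℝ, Φ p * Complex.exp (2 * π * I * ∑ j, (p j : ℂ) * z j)‖ ≤ K := by
  set c' : ℝ := (c + a) / 2 with hc'
  obtain ⟨C, N, hC⟩ := hdecay c' (by rw [hc']; linarith)
  have hδ : 0 < 2 * π * (c' - c) := by rw [hc']; nlinarith [Real.pi_pos]
  refine ⟨∫ p : Fin k → ℝ, C * ((1 + ‖p‖) ^ N * Real.exp (-(2 * π * (c' - c)) * ‖p‖)), fun z hz => ?_⟩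
  refine norm_integral_le_of_norm_le ((integrable_one_add_norm_pow_mul_exp_neg hδ N).const_mul C)
    (Eventually.of_forall fun p => ?_)
  rw [norm_mul]
  have hC0 : 0 ≤ C := by
    have h := hC 0
    simp only [norm_zero, add_zero, one_pow, mul_one, mul_zero, neg_zero, Real.exp_zero] at h
    exact (norm_nonneg _).trans h
  calc ‖Φ p‖ * ‖Complex.exp (2 * π * I * ∑ j, (p j : ℂ) * z j)‖
      ≤ (C * (1 + ‖p‖) ^ N * Real.exp (-(2 * π * c' * ‖p‖))) * Real.exp (2 * π * ‖p‖ * c) := by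
        refine mul_le_mul (hC p) ((norm_cexp_two_pi_I_sum_le p z).trans (Real.exp_le_exp.2 ?_))
          (norm_nonneg _) (le_trans (norm_nonneg _) (hC p))
        exact mul_le_mul_of_nonneg_left hz (by positivity)
    _ = C * ((1 + ‖p‖) ^ N * Real.exp (-(2 * π * (c' - c)) * ‖p‖)) := by
        rw [mul_assoc, mul_assoc, mul_assoc, ← Real.exp_add]
        congr 3
        ring

/-! ### The real restriction integrates Schwartz products to the Fourier data -/

/-- The inverse Fourier transform on `ℝ` as an exponential integral:
`𝓕⁻ f p = ∫ e^{2πi x p} f(x) dx`. [folklore] -/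
theorem fourierInv_real_eq_integral_exp_mul (f : ℝ → ℂ) (p : ℝ) :
    𝓕⁻ f p = ∫ x : ℝ, Complex.exp (↑(2 * π * x * p) * I) * f x := by
  rw [Real.fourierInv_eq_fourier_neg, Real.fourier_real_eq_integral_exp_smul]
  refine integral_congr_ae (Eventually.of_forall fun x => ?_)
  simp only [smul_eq_mul]
  congr 2
  push_cast
  ring

/-- **The real restriction of the Fourier–Laplace integral against a Schwartz product**: for
continuous integrable `Φ`,
`∫ (∫ Φ(p) e^{2πi p·x} dp) ∏ ϑⱼ(xⱼ) dx = ∫ Φ(p) ∏ (𝓕⁻ϑⱼ)(pⱼ) dp` (Fubini, and the kernel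
factorises over the coordinates). [folklore] -/
theorem integral_fourierLaplace_mul_prod_eq {Φ : (Fin k → ℝ) → ℂ} (hΦ : Continuous Φ)
    (hint : Integrable Φ) (ϑ : Fin k → 𝓢(ℝ, ℂ)) :
    ∫ x : Fin k → ℝ, (∫ p : Fin k → ℝ, Φ p * Complex.exp (2 * π * I * ∑ j, (p j : ℂ) * (x j : ℂ))) *
        ∏ j, ϑ j (x j) =
      ∫ p : Fin k → ℝ, Φ p * ∏ j, (𝓕⁻ (ϑ j) : 𝓢(ℝ, ℂ)) (p j) := by
  -- the kernel factorises
  have hker : ∀ (p x : Fin k → ℝ), Complex.exp (2 * π * I * ∑ j, (p j : ℂ) * (x j : ℂ)) =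
      ∏ j, Complex.exp (↑(2 * π * x j * p j) * I) := by
    intro p x
    rw [Finset.mul_sum, Complex.exp_sum]
    refine Finset.prod_congr rfl fun j _ => ?_
    congr 1
    push_cast
    ring
  -- integrability on the product space
  have hprod : Integrable (fun z : (Fin k → ℝ) × (Fin k → ℝ) =>
      Φ z.2 * Complex.exp (2 * π * I * ∑ j, (z.2 j : ℂ) * (z.1 j : ℂ)) * ∏ j, ϑ j (z.1 j))
      ((volume : Measure (Fin k → ℝ)).prod volume) := by
    have h1 : Integrable (fun z : (Fin k → ℝ) × (Fin k → ℝ) => (∏ j, ϑ j (z.1 j)) * Φ z.2)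
        ((volume : Measure (Fin k → ℝ)).prod volume) :=
      (Integrable.fintype_prod (f := fun j (x : ℝ) => ϑ j x) fun j => (ϑ j).integrable).mul_prod hint
    have hc1 : Continuous fun z : (Fin k → ℝ) × (Fin k → ℝ) => Φ z.2 := hΦ.comp continuous_snd
    have hc2 : Continuous fun z : (Fin k → ℝ) × (Fin k → ℝ) =>
        Complex.exp (2 * π * I * ∑ j, (z.2 j : ℂ) * (z.1 j : ℂ)) :=
      Complex.continuous_exp.comp (continuous_const.mul (continuous_finsetSum _ fun j _ =>
        (Complex.continuous_ofReal.comp ((continuous_apply j).comp continuous_snd)).mul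
          (Complex.continuous_ofReal.comp ((continuous_apply j).comp continuous_fst))))
    have hc3 : Continuous fun z : (Fin k → ℝ) × (Fin k → ℝ) => ∏ j, ϑ j (z.1 j) :=
      continuous_finsetProd _ fun j _ => (ϑ j).continuous.comp ((continuous_apply j).comp continuous_fst)
    refine h1.mono ((hc1.mul hc2).mul hc3).aestronglyMeasurable (Eventually.of_forall fun z => ?_)
    have hre0 : (2 * π * I * ∑ j, (z.2 j : ℂ) * (z.1 j : ℂ)).re = 0 := by
      simp [mul_re, mul_im, re_sum, im_sum]
    rw [norm_mul, norm_mul, norm_mul, Complex.norm_exp, hre0, Real.exp_zero, mul_one, mul_comm]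
  calc ∫ x : Fin k → ℝ, (∫ p : Fin k → ℝ, Φ p * Complex.exp (2 * π * I * ∑ j, (p j : ℂ) * (x j : ℂ))) *
          ∏ j, ϑ j (x j)
      = ∫ x : Fin k → ℝ, ∫ p : Fin k → ℝ, Φ p * Complex.exp (2 * π * I * ∑ j, (p j : ℂ) * (x j : ℂ)) *
          ∏ j, ϑ j (x j) := by
        refine integral_congr_ae (Eventually.of_forall fun x => ?_)
        exact (integral_mul_const _ _).symm
    _ = ∫ p : Fin k → ℝ, ∫ x : Fin k → ℝ, Φ p * Complex.exp (2 * π * I * ∑ j, (p j : ℂ) * (x j : ℂ)) *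
          ∏ j, ϑ j (x j) := integral_integral_swap hprod
    _ = ∫ p : Fin k → ℝ, Φ p * ∏ j, (𝓕⁻ (ϑ j) : 𝓢(ℝ, ℂ)) (p j) := by
        refine integral_congr_ae (Eventually.of_forall fun p => ?_)
        beta_reduce
        have hshape : (fun x : Fin k → ℝ => Φ p * Complex.exp (2 * π * I * ∑ j, (p j : ℂ) * (x j : ℂ)) *
            ∏ j, ϑ j (x j)) = fun x => Φ p * (Complex.exp (2 * π * I * ∑ j, (p j : ℂ) * (x j : ℂ)) *
            ∏ j, ϑ j (x j)) := by
          funext x; ring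
        rw [hshape, integral_const_mul]
        congr 1
        simp_rw [hker, ← Finset.prod_mul_distrib]
        rw [integral_fintype_prod_volume_eq_prod (f := fun j (x : ℝ) =>
          Complex.exp (↑(2 * π * x * p j) * I) * ϑ j x)]
        refine Finset.prod_congr rfl fun j _ => ?_
        rw [SchwartzMap.fourierInv_coe, fourierInv_real_eq_integral_exp_mul]

/-! ### The flat tube theorem -/

/-- **The Malgrange–Zerner "flat tube" theorem in tempered form (Fourier-transform proof).**
Let `a, b > 0`, `κ ∈ ℝ`, and let `T` be a functional on `k`-tuples of functions `ℝ → ℂ` with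
bound functionals `Bᵢ` such that

* (slot representations) for every slot `i` and every tuple `θ` of Schwartz functions there is
  `g` holomorphic in the strip `{|Im z| < a}`, with `‖g(x + iy)‖ ≤ Bᵢ(θ, c) e^{κ|x|}` for
  `|y| ≤ c < a`, representing slot `i` of `T` at `θ`: `T(θ[i ↦ ϑ]) = ∫ g(s) e^{-bs²} ϑ(s) ds` for
  all Schwartz `ϑ`;
* (polynomial bounds in the frequencies) for every `c < a` there are `C, N` with
  `Bᵢ((ψ_{p_j})_j, c) ≤ C (1 + ‖p‖)ᴺ` at the tuples of modulated Gaussians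
  `ψ_q(s) = e^{-bs²} e^{-2πiqs}`, `‖p‖ = maxⱼ |pⱼ|`.

Then there is `F : ℂᵏ → ℂ`, complex differentiable on the tube over the `ℓ¹`-ball
`{∑ⱼ |Im zⱼ| < a}` (the convex hull of the `k` flat tubes `{|Im zᵢ| < a, Im z_l = 0 (l ≠ i)}`) and
bounded on each closed sub-tube `{∑ⱼ |Im zⱼ| ≤ c}`, `c < a`, such that

  `T(e^{-b·²}ϑ₁, …, e^{-b·²}ϑ_k) = ∫_{ℝᵏ} F(x) ∏ⱼ ϑⱼ(xⱼ) dx`  for all Schwartz `ϑ₁, …, ϑ_k`.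

(`F` is the Fourier–Laplace integral of the Gaussian-windowed Fourier data of `T`; module
docstring. In the language of distributions: a tempered distribution in `k` variables each of whose
slots is, for frozen test functions in the other slots, a function holomorphic and of exponential
type in a horizontal strip, is a function holomorphic in the tube over the convex hull of the flat
tubes — Epstein's form of the theorem for distributions, here with growth hypotheses and an
explicit construction.) [folklore] -/
theorem exists_holomorphic_extension_l1Tube (ha : 0 < a) (hb : 0 < b)
    (T : (Fin k → ℝ → ℂ) → ℂ) (B : Fin k → (Fin k → ℝ → ℂ) → ℝ → ℝ)
    (hT : ∀ (i : Fin k) (θ : Fin k → 𝓢(ℝ, ℂ)), ∃ g : ℂ → ℂ,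
      DifferentiableOn ℂ g {z : ℂ | |z.im| < a} ∧
      (∀ c : ℝ, c < a → ∀ z : ℂ, |z.im| ≤ c →
        ‖g z‖ ≤ B i (fun j => ⇑(θ j)) c * Real.exp (κ * |z.re|)) ∧
      ∀ ϑ : 𝓢(ℝ, ℂ), T (Function.update (fun j => ⇑(θ j)) i ϑ) =
        ∫ s : ℝ, g s * Complex.exp (-(b : ℂ) * (s : ℂ) ^ 2) * ϑ s)
    (hB : ∀ c : ℝ, c < a → ∃ (C : ℝ) (N : ℕ), ∀ (i : Fin k) (p : Fin k → ℝ),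
      B i (fun j (s : ℝ) => Complex.exp (-(b : ℂ) * (s : ℂ) ^ 2) *
        Complex.exp (↑(-2 * π * s * p j) * I)) c ≤ C * (1 + ‖p‖) ^ N) :
    ∃ F : (Fin k → ℂ) → ℂ,
      DifferentiableOn ℂ F {z : Fin k → ℂ | ∑ j, |(z j).im| < a} ∧
      (∀ c : ℝ, c < a → ∃ K : ℝ, ∀ z : Fin k → ℂ, ∑ j, |(z j).im| ≤ c → ‖F z‖ ≤ K) ∧
      ∀ ϑ : Fin k → 𝓢(ℝ, ℂ),
        T (fun j (s : ℝ) => Complex.exp (-(b : ℂ) * (s : ℂ) ^ 2) * ϑ j s) =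
          ∫ x : Fin k → ℝ, F (fun j => (x j : ℂ)) * ∏ j, ϑ j (x j) := by
  -- the Gaussian-windowed Fourier data
  set Φ : (Fin k → ℝ) → ℂ := fun p => T (fun j (s : ℝ) =>
    Complex.exp (-(b : ℂ) * (s : ℂ) ^ 2) * Complex.exp (↑(-2 * π * s * p j) * I)) with hΦdef
  -- slot representations at tuples of modulated Gaussians
  have hslot : ∀ (p : Fin k → ℝ) (i : Fin k), ∃ g : ℂ → ℂ,
      DifferentiableOn ℂ g {z : ℂ | |z.im| < a} ∧
      (∀ c : ℝ, c < a → ∀ z : ℂ, |z.im| ≤ c →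
        ‖g z‖ ≤ B i (fun j (s : ℝ) => Complex.exp (-(b : ℂ) * (s : ℂ) ^ 2) *
          Complex.exp (↑(-2 * π * s * p j) * I)) c * Real.exp (κ * |z.re|)) ∧
      ∀ ϑ : 𝓢(ℝ, ℂ), T (Function.update (fun j (s : ℝ) => Complex.exp (-(b : ℂ) * (s : ℂ) ^ 2) *
          Complex.exp (↑(-2 * π * s * p j) * I)) i ϑ) =
        ∫ s : ℝ, g s * Complex.exp (-(b : ℂ) * (s : ℂ) ^ 2) * ϑ s := by
    intro p i
    choose θ hθ using fun j => exists_schwartzMap_gaussMod hb (p j)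
    have hθfun : (fun j => ⇑(θ j)) = fun j (s : ℝ) => Complex.exp (-(b : ℂ) * (s : ℂ) ^ 2) *
        Complex.exp (↑(-2 * π * s * p j) * I) := funext fun j => funext (hθ j)
    obtain ⟨g, hg, hM, hrep⟩ := hT i θ
    rw [hθfun] at hM hrep
    exact ⟨g, hg, hM, hrep⟩
  -- real-line polynomial bounds (`c = 0`): continuity and integrability of `Φ`
  obtain ⟨C₀, N₀, hC₀⟩ := hB 0 ha
  have hslot0 : ∀ (p : Fin k → ℝ) (i : Fin k), ∃ g : ℂ → ℂ, ContinuousOn g {z : ℂ | |z.im| < a} ∧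
      (∀ x : ℝ, ‖g x‖ ≤ C₀ * (1 + ‖p‖) ^ N₀ * Real.exp (κ * |x|)) ∧
      ∀ ϑ : 𝓢(ℝ, ℂ), T (Function.update (fun j (s : ℝ) => Complex.exp (-(b : ℂ) * (s : ℂ) ^ 2) *
          Complex.exp (↑(-2 * π * s * p j) * I)) i ϑ) =
        ∫ s : ℝ, g s * Complex.exp (-(b : ℂ) * (s : ℂ) ^ 2) * ϑ s := by
    intro p i
    obtain ⟨g, hg, hM, hrep⟩ := hslot p i
    refine ⟨g, hg.continuousOn, fun x => ?_, hrep⟩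
    have h := hM 0 ha x (by simp)
    simp only [ofReal_re] at h
    exact h.trans (mul_le_mul_of_nonneg_right (hC₀ i p) (Real.exp_pos _).le)
  have hΦc : Continuous Φ := continuous_apply_gaussMod hb ha hslot0
  -- decay for every `c < a`
  have hdecay : ∀ c : ℝ, c < a → ∃ (C : ℝ) (N : ℕ), ∀ p,
      ‖Φ p‖ ≤ C * (1 + ‖p‖) ^ N * Real.exp (-(2 * π * c * ‖p‖)) := by
    intro c hca
    rcases isEmpty_or_nonempty (Fin k) with hk | hk
    · -- no variables: `Φ` is constant and `‖p‖ = 0`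
      refine ⟨‖Φ 0‖, 0, fun p => ?_⟩
      have hp : p = 0 := Subsingleton.elim _ _
      subst hp
      simp
    · set c' : ℝ := max c 0 with hc'
      have hc'0 : 0 ≤ c' := le_max_right _ _
      have hc'a : c' < a := max_lt hca ha
      obtain ⟨C, N, hC⟩ := hB c' hc'a
      refine ⟨C * Real.exp (2 * b * c' ^ 2) * ∫ x : ℝ, Real.exp (κ * |x| - 2 * b * x ^ 2), N,
        fun p => ?_⟩
      have hslotc : ∀ i : Fin k, ∃ g : ℂ → ℂ, DifferentiableOn ℂ g {z : ℂ | |z.im| < a} ∧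
          (∀ z : ℂ, |z.im| ≤ c' → ‖g z‖ ≤ C * (1 + ‖p‖) ^ N * Real.exp (κ * |z.re|)) ∧
          ∀ ϑ : 𝓢(ℝ, ℂ), T (Function.update (fun j (s : ℝ) => Complex.exp (-(b : ℂ) * (s : ℂ) ^ 2) *
              Complex.exp (↑(-2 * π * s * p j) * I)) i ϑ) =
            ∫ s : ℝ, g s * Complex.exp (-(b : ℂ) * (s : ℂ) ^ 2) * ϑ s := by
        intro i
        obtain ⟨g, hg, hM, hrep⟩ := hslot p i
        exact ⟨g, hg, fun z hz => (hM c' hc'a z hz).trans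
          (mul_le_mul_of_nonneg_right (hC i p) (Real.exp_pos _).le), hrep⟩
      have h := norm_apply_gaussMod_le hb hc'0 hc'a hslotc
      refine h.trans ?_
      -- `e^{-2πc'‖p‖} ≤ e^{-2πc‖p‖}` and the prefactor is nonnegative
      obtain ⟨i⟩ := hk
      obtain ⟨g, -, hM, -⟩ := hslotc i
      have hCp : 0 ≤ C * (1 + ‖p‖) ^ N :=
        nonneg_of_norm_le_mul_exp (κ := κ) fun x => by simpa using hM x (by simpa using hc'0)
      have hK : 0 ≤ ∫ x : ℝ, Real.exp (κ * |x| - 2 * b * x ^ 2) :=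
        (integral_exp_mul_abs_sub_mul_sq_pos (by positivity : 0 < 2 * b) κ).le
      have hexp : Real.exp (-(2 * π * c' * ‖p‖)) ≤ Real.exp (-(2 * π * c * ‖p‖)) := by
        have hcc : c * ‖p‖ ≤ c' * ‖p‖ := mul_le_mul_of_nonneg_right (le_max_left c 0) (norm_nonneg p)
        exact Real.exp_le_exp.2 (by nlinarith [hcc, Real.pi_pos])
      calc C * Real.exp (2 * b * c' ^ 2) * (∫ x : ℝ, Real.exp (κ * |x| - 2 * b * x ^ 2)) *
            (1 + ‖p‖) ^ N * Real.exp (-(2 * π * c' * ‖p‖))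
          = (C * (1 + ‖p‖) ^ N) * (Real.exp (2 * b * c' ^ 2) *
              ∫ x : ℝ, Real.exp (κ * |x| - 2 * b * x ^ 2)) * Real.exp (-(2 * π * c' * ‖p‖)) := by ring
        _ ≤ (C * (1 + ‖p‖) ^ N) * (Real.exp (2 * b * c' ^ 2) *
              ∫ x : ℝ, Real.exp (κ * |x| - 2 * b * x ^ 2)) * Real.exp (-(2 * π * c * ‖p‖)) := by
            gcongr
        _ = C * Real.exp (2 * b * c' ^ 2) * (∫ x : ℝ, Real.exp (κ * |x| - 2 * b * x ^ 2)) *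
            (1 + ‖p‖) ^ N * Real.exp (-(2 * π * c * ‖p‖)) := by ring
  -- the Fourier–Laplace integral
  refine ⟨fun z => ∫ p : Fin k → ℝ, Φ p * Complex.exp (2 * π * I * ∑ j, (p j : ℂ) * z j),
    differentiableOn_fourierLaplace_l1Tube hΦc hdecay, fun c hca => norm_fourierLaplace_le hdecay hca,
    fun ϑ => ?_⟩
  -- integrability of `Φ` (decay at `c = a/2 > 0`)
  have hΦint : Integrable Φ := by
    obtain ⟨C, N, hC⟩ := hdecay (a / 2) (by linarith)
    refine ((integrable_one_add_norm_pow_mul_exp_neg (by positivity : 0 < 2 * π * (a / 2)) N).const_mul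
      C).mono' hΦc.aestronglyMeasurable (Eventually.of_forall fun p => (hC p).trans (le_of_eq ?_))
    rw [mul_assoc]
    congr 2
    ring
  -- synthesis (`FlatTubeFourierSynthesis`) and Fubini
  have hsyn := apply_gaussian_mul_eq_integral_fourierData (κ := κ) hb ha k T (fun i θ => ?_)
    ⟨C₀, N₀, hslot0⟩ ϑ
  · rw [hsyn, ← integral_fourierLaplace_mul_prod_eq hΦc hΦint ϑ]
  · obtain ⟨g, hg, hM, hrep⟩ := hT i θ
    exact ⟨g, hg.continuousOn, ⟨B i (fun j => ⇑(θ j)) 0, fun x => by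
      simpa using hM 0 ha x (by simp)⟩, hrep⟩

end Literature.Analysis.Complex
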